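import Summits.MatrixMultiplication.MatrixMultiplication.Theorems.CharacteristicContinuityUniformWitness
import HarnessLib

/-!
# CharacteristicContinuityEventualTransfer — the residual of the characteristic axis, weakened
(decomp-mm cell, lens 5 «finite/base range + asymptotic regime + bridge», generation 10)

Support file for `route-MatrixMultiplication-CharacteristicContinuity` (`Theses/CharacteristicContinuity.lean`,
items `ContinuityAtZero` = K, 18039, the declared residual; `LargeCharacteristicFast` = W, 18040).

The route decides `ω(ℂ) = 2` as `W ∧ K` with
* W : `ω(𝔽̄_p) → 2` (`∀ ε, ∀ᶠ p, ω_p ≤ 2 + ε`),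
* K : `ω(ℂ) ≤ liminf_p ω(𝔽̄_p)` (`∀ ε, ∀ᶠ p, ω(ℂ) ≤ ω_p + ε`) — lower semicontinuity at characteristic `0`.

This file records that the residual can be taken STRICTLY WEAKER at no cost to exactness:

* K′ («eventual transfer», `ω(ℂ) ≤ limsup_p ω(𝔽̄_p)`):
  `∀ β, (∀ᶠ p, ω_p ≤ β) → ω(ℂ) ≤ β` — an exponent bound valid in ALL large characteristics
  transfers to characteristic zero (K asks this of bounds valid in infinitely many characteristics).
* `eventualTransfer_of_continuityAtZero : K → K′`;
  `closes_of_eventualTransfer : W → K′ → ω(ℂ) = 2`;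
  `matrixMultiplication_iff_fast_and_eventualTransfer : ω(ℂ) = 2 ↔ W ∧ K′` (exact cut, K′ the residual).
* The two weakenings are DUAL and cannot be combined: with A := «ω_p clusters at 2»
  (`∀ ε, ∃ᶠ p, ω_p ≤ 2 + ε`, the weaker reading of W) one has the exact cut
  `matrixMultiplication_iff_cluster_and_continuity : ω(ℂ) = 2 ↔ A ∧ K`, while `A ∧ K′` is NOT a cut:
  `schema_cluster_and_eventual_not_exact` exhibits an exponent profile (ω₀ = 5/2, ω_p alternating
  2 and 5/2) satisfying every proved law of the axis (`2 ≤ ω_p`, `limsup ω_p ≤ ω₀`) together with A and K′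
  but not `ω₀ = 2`; the same profile shows `K′ ↛ K` as a law (`schema_eventual_not_continuity`).
  So the axis has exactly two minimal exact corners, (W, K′) and (A, K): transfer along almost every
  prime pairs with convergence along almost every prime, transfer along infinitely many primes pairs
  with clustering along infinitely many primes.
* Lens reading («how far must the finite range reach»): `eventualTransfer_iff_uniformWitnessIO : K′ ↔`
  near-optimal witnesses `R_{𝔽̄_p}(⟨n,n,n⟩) ≤ n^{ω_p+ε}` of size `n ≤ N(ε)` occur for infinitely many `p`
  (K ↔ the same for all large `p`, landed `uniformWitnessIff_holds`).  The bridge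
  `fixedFormatContinuity_holds` bites on `ω` exactly when witness formats stay bounded along an
  infinite set of primes.

* `stub_transferDown` — the registered stub of item 18039: `R_{𝔽̄_p}(⟨n,n,n⟩) ≤ r` for infinitely many
  `p` gives `R_ℂ(⟨n,n,n⟩) ≤ r` (from `fixedFormatContinuity_holds`).

All statements are written out over the route's declarations (no new definitions).
References: [cite: BurgisserClausenShokrollahi1997, Cor. (15.18), §15.3]; [cite: Blaser2013, Def. 5.1];
[cite: Schonhage1981, Thm 2.8 (field-extension invariance)].
-/

set_option linter.dupNamespace false -- `MatrixMultiplication.MatrixMultiplication` (summit = problem, D-0017)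

noncomputable section

open Filter Finset
open Literature.Computability.AlgebraicComplexity
open Summit.MatrixMultiplication.MatrixMultiplication.Theses.CharacteristicContinuity
open Summit.MatrixMultiplication.MatrixMultiplication.Theorems.CharacteristicContinuityTransfer
open Summit.MatrixMultiplication.MatrixMultiplication.Theorems.CharacteristicContinuityFixedFormat

namespace Summit.MatrixMultiplication.MatrixMultiplication.Theorems.CharacteristicContinuityEventualTransfer

/-! ## K′ is implied by K and still closes with W -/

/-- `K → K′`: lower semicontinuity at characteristic zero implies eventual transfer
(`ω(ℂ) ≤ liminf ω_p ≤ limsup ω_p`). [cite: BurgisserClausenShokrollahi1997, Cor. (15.18)] -/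
theorem eventualTransfer_of_continuityAtZero (hK : ContinuityAtZero) :
    ∀ β : ℝ, (∃ p₀ : ℕ, ∀ (p : ℕ) [Fact p.Prime], p₀ ≤ p → omega (AlgebraicClosure (ZMod p)) ≤ β) →
      omega ℂ ≤ β := by
  rintro β ⟨p₀, hβ⟩
  refine le_of_forall_pos_le_add fun δ hδ => ?_
  obtain ⟨p₁, h₁⟩ := hK δ hδ
  obtain ⟨p, hp, hprime⟩ := Nat.exists_infinite_primes (max p₀ p₁)
  haveI : Fact p.Prime := ⟨hprime⟩
  have a := hβ p ((le_max_left _ _).trans hp)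
  have b := h₁ p ((le_max_right _ _).trans hp)
  linarith

/-- `W → K′ → ω(ℂ) = 2`: the weakened residual still closes with `LargeCharacteristicFast`
(apply K′ to the eventual bounds `ω_p ≤ 2 + δ`). [cite: BurgisserClausenShokrollahi1997, §15.3] -/
theorem closes_of_eventualTransfer (hW : LargeCharacteristicFast)
    (hK' : ∀ β : ℝ, (∃ p₀ : ℕ, ∀ (p : ℕ) [Fact p.Prime], p₀ ≤ p → omega (AlgebraicClosure (ZMod p)) ≤ β) →
      omega ℂ ≤ β) :
    _root_.MatrixMultiplication := by
  rw [_root_.MatrixMultiplication_iff]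
  refine le_antisymm ?_ (omega_two_le ℂ)
  exact le_of_forall_pos_le_add fun δ hδ => hK' (2 + δ) (hW δ hδ)

/-- **Exact cut with the weaker residual**: `ω(ℂ) = 2 ↔ W ∧ K′`.
[cite: BurgisserClausenShokrollahi1997, Cor. (15.18)] -/
theorem matrixMultiplication_iff_fast_and_eventualTransfer :
    _root_.MatrixMultiplication ↔ LargeCharacteristicFast ∧
      (∀ β : ℝ, (∃ p₀ : ℕ, ∀ (p : ℕ) [Fact p.Prime], p₀ ≤ p → omega (AlgebraicClosure (ZMod p)) ≤ β) →
        omega ℂ ≤ β) :=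
  ⟨fun hS => ⟨(converse_holds hS).1, eventualTransfer_of_continuityAtZero (converse_holds hS).2⟩,
    fun h => closes_of_eventualTransfer h.1 h.2⟩

/-! ## The dual corner: clustering at `2` with the liminf residual K -/

/-- **Exact cut (A, K)**: `ω(ℂ) = 2 ↔ (ω_p clusters at 2) ∧ ContinuityAtZero`, where A is the weaker
(infinitely-often) reading of `LargeCharacteristicFast`. [cite: BurgisserClausenShokrollahi1997, Cor. (15.18)] -/
theorem matrixMultiplication_iff_cluster_and_continuity :
    _root_.MatrixMultiplication ↔
      (∀ ε : ℝ, 0 < ε → ∀ p₀ : ℕ, ∃ (p : ℕ) (_ : Fact p.Prime), p₀ ≤ p ∧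
          omega (AlgebraicClosure (ZMod p)) ≤ 2 + ε) ∧ ContinuityAtZero := by
  constructor
  · intro hS
    refine ⟨fun ε hε p₀ => ?_, (converse_holds hS).2⟩
    obtain ⟨p₁, h₁⟩ := (converse_holds hS).1 ε hε
    obtain ⟨p, hp, hprime⟩ := Nat.exists_infinite_primes (max p₀ p₁)
    exact ⟨p, ⟨hprime⟩, (le_max_left _ _).trans hp, @h₁ p ⟨hprime⟩ ((le_max_right _ _).trans hp)⟩
  · rintro ⟨hA, hK⟩
    rw [_root_.MatrixMultiplication_iff]
    refine le_antisymm ?_ (omega_two_le ℂ)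
    refine le_of_forall_pos_le_add fun δ hδ => ?_
    obtain ⟨p₂, h₂⟩ := hK (δ / 2) (by positivity)
    obtain ⟨p, inst, hp, hAp⟩ := hA (δ / 2) (by positivity) p₂
    have b := @h₂ p inst hp
    linarith

/-! ## The weakenings are dual: schematic exponent profiles

The laws of the axis proved in the tree are `2 ≤ ω_p` (flattening), `ω_p ≤ ω(ℂ) + ε` eventually
(`lefschetzUpperBound_holds`) and fixed-format continuity.  Over an ARBITRARY profile `w : ℕ → ℝ` with a
characteristic-zero value `ω₀` obeying `2 ≤ w p ≤ ω₀`, the schemas of K′ and A hold while `ω₀ ≠ 2` and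
the schema of K fails: `K′ → K` and `A ∧ K′ → ω₀ = 2` are not consequences of these laws. -/

/-- The alternating profile `w p = 2` (odd `p`), `5/2` (even `p`), `ω₀ = 5/2`: obeys `2 ≤ w ≤ ω₀`,
satisfies the K′-schema and the A-schema, violates the K-schema, and `ω₀ ≠ 2`. -/
theorem schema_alternating_profile :
    ∃ (ω₀ : ℝ) (w : ℕ → ℝ), (∀ p, 2 ≤ w p ∧ w p ≤ ω₀) ∧
      (∀ β : ℝ, (∃ p₀ : ℕ, ∀ p, p₀ ≤ p → w p ≤ β) → ω₀ ≤ β) ∧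
      (∀ ε : ℝ, 0 < ε → ∀ p₀ : ℕ, ∃ p, p₀ ≤ p ∧ w p ≤ 2 + ε) ∧
      ¬ (∀ ε : ℝ, 0 < ε → ∃ p₀ : ℕ, ∀ p, p₀ ≤ p → ω₀ ≤ w p + ε) ∧
      ω₀ ≠ 2 := by
  refine ⟨5 / 2, fun p => if p % 2 = 0 then 5 / 2 else 2, fun p => ?_, ?_, ?_, ?_, by norm_num⟩
  · by_cases h : p % 2 = 0 <;> simp [h] <;> norm_num
  · rintro β ⟨p₀, hβ⟩
    have h := hβ (2 * p₀) (by omega)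
    have he : (2 * p₀) % 2 = 0 := by omega
    simpa [he] using h
  · intro ε hε p₀
    refine ⟨2 * p₀ + 1, by omega, ?_⟩
    have ho : (2 * p₀ + 1) % 2 = 1 := by omega
    simp [ho]; linarith
  · intro hK
    obtain ⟨p₀, h⟩ := hK (1 / 4) (by norm_num)
    have h1 := h (2 * p₀ + 1) (by omega)
    have ho : (2 * p₀ + 1) % 2 = 1 := by omega
    simp [ho] at h1
    linarith

/-- `K′ ↛ K` as a law of exponent profiles. -/
theorem schema_eventual_not_continuity :
    ¬ ∀ (ω₀ : ℝ) (w : ℕ → ℝ), (∀ p, 2 ≤ w p ∧ w p ≤ ω₀) →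
      (∀ β : ℝ, (∃ p₀ : ℕ, ∀ p, p₀ ≤ p → w p ≤ β) → ω₀ ≤ β) →
      (∀ ε : ℝ, 0 < ε → ∃ p₀ : ℕ, ∀ p, p₀ ≤ p → ω₀ ≤ w p + ε) := by
  intro h
  obtain ⟨ω₀, w, hlaw, hK', _, hnotK, _⟩ := schema_alternating_profile
  exact hnotK (h ω₀ w hlaw hK')

/-- `(A, K′)` is not an exact corner: clustering at `2` and eventual transfer do not force `ω₀ = 2`. -/
theorem schema_cluster_and_eventual_not_exact :
    ¬ ∀ (ω₀ : ℝ) (w : ℕ → ℝ), (∀ p, 2 ≤ w p ∧ w p ≤ ω₀) →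
      (∀ ε : ℝ, 0 < ε → ∀ p₀ : ℕ, ∃ p, p₀ ≤ p ∧ w p ≤ 2 + ε) →
      (∀ β : ℝ, (∃ p₀ : ℕ, ∀ p, p₀ ≤ p → w p ≤ β) → ω₀ ≤ β) → ω₀ = 2 := by
  intro h
  obtain ⟨ω₀, w, hlaw, hK', hA, _, hne⟩ := schema_alternating_profile
  exact hne (h ω₀ w hlaw hA hK')

/-! ## Registered stub of item 18039: downward transfer at a fixed format along infinitely many primes -/

/-- **Registered stub `stub_transferDown` of item 18039**: if `R_{𝔽̄_p}(⟨n,n,n⟩) ≤ r` for infinitely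
many primes `p`, then `R_ℂ(⟨n,n,n⟩) ≤ r` — complex rank LOWER bounds at a fixed format hold in all large
characteristics (the `≥`-half of `fixedFormatContinuity_holds`, Lefschetz principle on the Brent
sentence). [cite: BurgisserClausenShokrollahi1997, Cor. (15.18)] -/
theorem stub_transferDown : ∀ n r : ℕ, (∀ p₀ : ℕ, ∃ (p : ℕ) (_ : Fact p.Prime), p₀ ≤ p ∧ tensorRank (matMulTensor (AlgebraicClosure (ZMod p)) n n n) ≤ r) → tensorRank (matMulTensor ℂ n n n) ≤ r := by
  intro n r h
  obtain ⟨p₀, hp₀⟩ := fixedFormatContinuity_holds n n n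
  obtain ⟨p, inst, hp, hr⟩ := h p₀
  rw [← @hp₀ p inst hp]
  exact hr

/-! ## Lens reading of K′: bounded witness formats along an infinite set of primes -/

/-- **K′ in witness form**: eventual transfer holds iff for every `ε > 0` there is a format bound `N`
such that for INFINITELY MANY primes `p` some `n ≤ N` witnesses `R_{𝔽̄_p}(⟨n,n,n⟩) ≤ n^{ω_p + ε}`
(compare `uniformWitnessIff_holds`: K iff the same for ALL large `p`).  The proof of `←` is where the
theorem-bridge `fixedFormatContinuity_holds` bites. [cite: BurgisserClausenShokrollahi1997, Cor. (15.18)]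
[cite: Blaser2013, Def. 5.1] -/
theorem eventualTransfer_iff_uniformWitnessIO :
    (∀ β : ℝ, (∃ p₀ : ℕ, ∀ (p : ℕ) [Fact p.Prime], p₀ ≤ p → omega (AlgebraicClosure (ZMod p)) ≤ β) →
        omega ℂ ≤ β) ↔
      (∀ ε : ℝ, 0 < ε → ∃ N : ℕ, ∀ p₀ : ℕ, ∃ (p : ℕ) (_ : Fact p.Prime), p₀ ≤ p ∧ ∃ n : ℕ, 2 ≤ n ∧ n ≤ N ∧
        (tensorRank (matMulTensor (AlgebraicClosure (ZMod p)) n n n) : ℝ) ≤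
          (n : ℝ) ^ (omega (AlgebraicClosure (ZMod p)) + ε)) := by
  constructor
  · -- `K′ → witnesses i.o.`: one near-optimal complex format `N`, and K′ in contrapositive form.
    intro hK' ε hε
    obtain ⟨N, hN, p₁, hp₁⟩ := exists_format_eventually (γ := omega ℂ + ε / 2) (by linarith)
    refine ⟨N, fun p₀ => ?_⟩
    -- some prime `p ≥ max p₀ p₁` has `ω(ℂ) ≤ ω_p + ε/2`, else K′ bounds `ω(ℂ)` below itself
    by_contra hcon
    push Not at hcon
    have hβ : ∃ q₀ : ℕ, ∀ (p : ℕ) [Fact p.Prime], q₀ ≤ p →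
        omega (AlgebraicClosure (ZMod p)) ≤ omega ℂ - ε / 2 := by
      refine ⟨max p₀ p₁, fun p inst hp => ?_⟩
      by_contra hlt
      push Not at hlt
      have h1 := hp₁ p ((le_max_right _ _).trans hp)
      have hN1 : (1 : ℝ) ≤ N := by exact_mod_cast (le_trans one_le_two hN)
      have h2 : (tensorRank (matMulTensor (AlgebraicClosure (ZMod p)) N N N) : ℝ) ≤
          (N : ℝ) ^ (omega (AlgebraicClosure (ZMod p)) + ε) :=
        h1.trans (Real.rpow_le_rpow_of_exponent_le hN1 (by linarith))
      exact absurd h2 (not_le.2 (hcon p inst ((le_max_left _ _).trans hp) N hN le_rfl))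
    have := hK' _ hβ
    linarith
  · -- `witnesses i.o. → K′`: fixed-format continuity at the finitely many formats `n ≤ N`.
    intro hU β ⟨p₀, hβ⟩
    refine le_of_forall_pos_le_add fun δ hδ => ?_
    obtain ⟨N, hNp⟩ := hU δ hδ
    have hff : ∀ j : Fin (N + 1), ∃ p₁ : ℕ, ∀ (p : ℕ) [Fact p.Prime], p₁ ≤ p →
        tensorRank (matMulTensor (AlgebraicClosure (ZMod p)) j j j) =
          tensorRank (matMulTensor ℂ j j j) :=
      fun j => fixedFormatContinuity_holds j j j
    choose P hP using hff
    obtain ⟨p, inst, hp, n, hn2, hnN, hrank⟩ := hNp (max p₀ (Finset.univ.sup P))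
    have hPn : P ⟨n, Nat.lt_succ_of_le hnN⟩ ≤ p :=
      (Finset.le_sup (f := P) (Finset.mem_univ _)).trans ((le_max_right _ _).trans hp)
    have heq : tensorRank (matMulTensor (AlgebraicClosure (ZMod p)) n n n) =
        tensorRank (matMulTensor ℂ n n n) := @hP ⟨n, Nat.lt_succ_of_le hnN⟩ p inst hPn
    have hω : omega ℂ ≤ omega (AlgebraicClosure (ZMod p)) + δ := by
      refine omega_le_of_tensorRank_le_rpow ℂ hn2 ?_
      rw [← heq]
      exact hrank
    have hb := @hβ p inst ((le_max_left _ _).trans hp)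
    linarith

end Summit.MatrixMultiplication.MatrixMultiplication.Theorems.CharacteristicContinuityEventualTransfer

end
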